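import Summits.QuantumFields.YangMills.Theorems.BalabanLadderIRPinnedExitCofinal
import Summits.QuantumFields.YangMills.Theorems.IR.Negative.ColdExitAtVacuityThreshold
import HarnessLib

/-!
# The pinned bills PX = `PinnedExitAt θ` (slot of record on 19354) and PXcof (slot of record on 26930) are trivially TRUE for `θ ≥ 1`

Negative-lane calibration (typed-kill lineage ym-19354-disprove-1, memo §23.9 / §23.12) of the two bills of record after the cofinal
re-typing R423/R424: `PinnedExit96.PinnedExitAt θ` (LEAD slot `pinned_exit_96_bill` on stmt-QuantumFields-19354) and its cofinal form
PXcof (`PinnedExitsCofinalAt θ`, LEAD slot `pinned_cofinal_bill` on stmt-QuantumFields-26930; spelled out here since the slot's `def`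
lives in a `Lines/` workfile — the body below is VERBATIM the hypothesis of the landed `PinnedExitCofinal.ircofSC_of_pinnedExitsCofinal_le`).

* `pinnedExitAt_of_one_le` — `1 ≤ θ → PinnedExitAt θ`: the floor hypothesis `LowerBounds G r a` is NOT used; `a → 0` alone puts
  `a(β)·8 ≤ 8 =: T` eventually, and `δᶜ < 1 ≤ θ` always (`BasinRung.Negative.coldDefect_lt_one`).
* `pinnedExitsCofinalAt_of_one_le` — the same for the cofinal body PXcof (via the landed `pinnedExitsCofinal_of_pinnedExitAt`).

So the vacuity threshold of both pinned bills is `θ = 1` irrespective of the floor; the registered `θ = 1/24` is contentful.  The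
LOWER calibration (`θ < 0` false), available for the unguarded seeds E and K1 (`not_coldExitAt_of_neg`, `not_cofinalExitAt_of_neg`),
does NOT transfer: a kernel `¬ PinnedExitAt θ` must exhibit `(G, r, a)` WITH a `LowerBounds G r a` witness, and the tree has no
unconditional constructor of `LowerBounds` — the pinned bills are conditional in the way `IR` is.  Nothing here proves or refutes
PX(1/24), PXcof(1/24), `IR`, `IRcof` or any summit conjunct.
-/

noncomputable section

open Filter Topology
open Literature.MathematicalPhysics.QuantumFieldTheory
open Summit.QuantumFields.YangMills.Cruxes.OSLegsFromFemtoAndGap.DlrCollarTransfer (LowerBounds)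
open Summit.QuantumFields.YangMills.Cruxes.IR.ColdPurityBridge (coldDefect)
open Summit.QuantumFields.YangMills.Cruxes.IR.PinnedExit96 (PinnedExitAt)
open Summit.QuantumFields.YangMills.Cruxes.IR.PinnedExitCofinal (pinnedExitsCofinal_of_pinnedExitAt)

namespace Summit.QuantumFields.YangMills.Cruxes.IR.PinnedExit96.Negative

/-- **PX(θ) is trivially true for `θ ≥ 1`** (floor unused; `T = 8`, `L = 8`, `δᶜ < 1`). [folklore] -/
theorem pinnedExitAt_of_one_le {θ : ℝ} (hθ : 1 ≤ θ) : PinnedExitAt θ := by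
  intro G _ _ _ _ _hG _hsc
  letI : MeasurableSpace G := borel G
  haveI : BorelSpace G := ⟨rfl⟩
  intro r a _ha ha0 _hlb
  haveI : SecondCountableTopology G :=
    (r.continuous.isClosedEmbedding r.injective).isEmbedding.secondCountableTopology
  obtain ⟨β₁, hβ₁⟩ := Filter.eventually_atTop.1 (ha0.eventually (gt_mem_nhds (zero_lt_one' ℝ)))
  refine ⟨8, β₁, fun β hβ => ⟨8, le_rfl, ?_, (BasinRung.Negative.coldDefect_lt_one r.continuous β 8).le.trans hθ⟩⟩
  have h1 : a β < 1 := hβ₁ β hβ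
  have : a β * ((8 : ℕ) : ℝ) ≤ 1 * ((8 : ℕ) : ℝ) := by
    exact mul_le_mul_of_nonneg_right h1.le (by positivity)
  simpa using this

/-- **PXcof(θ) is trivially true for `θ ≥ 1`** (the cofinal body, verbatim the hypothesis of
`PinnedExitCofinal.ircofSC_of_pinnedExitsCofinal_le`; from `pinnedExitAt_of_one_le` by the landed PX ⇒ PXcof). [folklore] -/
theorem pinnedExitsCofinalAt_of_one_le {θ : ℝ} (hθ : 1 ≤ θ) :
    ∀ (G : Type) [Group G] [TopologicalSpace G] [IsTopologicalGroup G] [CompactSpace G],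
      IsCompactSimpleLieGroup G → SimplyConnectedSpace G →
      letI : MeasurableSpace G := borel G
      haveI : BorelSpace G := ⟨rfl⟩
      ∀ (r : LatticeRep G) (a : ℝ → ℝ), (∀ β, 0 < a β) → Tendsto a atTop (𝓝 0) → LowerBounds G r a →
        ∃ T : ℝ, ∀ β₁ : ℝ, ∃ β : ℝ, β₁ ≤ β ∧ ∃ L : ℕ, 8 ≤ L ∧ a β * (L : ℝ) ≤ T ∧ coldDefect r.ρ β L ≤ θ :=
  pinnedExitsCofinal_of_pinnedExitAt (pinnedExitAt_of_one_le hθ)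

end Summit.QuantumFields.YangMills.Cruxes.IR.PinnedExit96.Negative

end
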